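import Summits.HodgeConjecture.HodgeConjecture.Theorems.Ring2WeilCoverageCyclotomicPrincipalObstruction
import HarnessLib

/-!
# Weil-type family coverage — the real cyclotomic units `c_a = (ζ^a − ζ^{−a})/(ζ − ζ^{−1})` of `ℚ(ζ₂₁)`:
# units of `𝓞 K`, fixed by conjugation, with `φ_t(c_a) = sin(2πat/21)/sin(2πt/21)` — their SIGNS are combinatorial

research route conditional on HC_CM; not a corollary; Q11.4-sentence-2 already refuted in dim ≥ 3.

Ring 2, WEIL-TYPE FAMILY-COVERAGE CENSUS (`HOME/WEIL-FAMILY-COVERAGE.md` `## b01`, blocks b01.23 (A) «explicit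
cyclotomic units exhibit the even hyperplane» and b01.28 THEOREM L (ii) «`Sig(E⁺)` = the even-weight hyperplane
when `h(ℚ(ζ_M)) = 1`», owner ring2-b01), part 11 of the `Ring2WeilCoverage*` series.  Part 7
(`…CyclotomicPrincipalObstruction`) proved the census's YES verdict modulo the hypothesis `hU'` (every even sign
pattern on `Φ` is a real unit's); this file provides the units for `M = 21`, and part 12
(`…CyclotomicTwentyOneSignatures`) discharges `hU'` there.  With `ζ` a primitive `21`-st root of unity and
`c_a := Σ_{j<a} ζ^{a−1+19j}` (`= Σ_{j<a} ζ^{a−1−2j} = (ζ^a − ζ^{−a})/(ζ − ζ^{−1})`, written with natural exponents,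
`ζ^{−2} = ζ^{19}`):

* §1 (any commutative ring) `csum_mul_sub`: **`c_a·(z − z^{20}) = z^a − z^{20a}`** (telescoping);
  `csum_mul_csum_eq_one`: for `z^{21} = 1`, `z ≠ z^{20}`, `ab ≡ 1 (mod 21)`: **`c_a(z)·c_b(z^a) = 1`** — so `c_a` is
  a unit with inverse `c_b(ζ^a)`.
* §2 `sin_two_pi_mul_div_neg_iff`: for naturals `m, n` with `n ∤ m`, `2(m mod n) ≠ n`:
  **`sin(2πm/n) < 0 ↔ n < 2(m mod n)`**, and `≠ 0`.
* §3 `embedding_csum_eq`: for an embedding `φ` of a number field `K ∋ ζ` with `φ ζ = 𝐞(t)` (`t` a unit residue):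
  **`φ(c_a) = sin(2πat/21)/sin(2πt/21)`** (real), via `𝐞(t)^k − 𝐞(t)^{−k} = 2i·sin(2πkt/21)`.
* §4 `re_embedding_csum`: **`Re φ(c_a) < 0 ↔ Xor (21 < 2((at) mod 21)) (21 < 2t)`** for `a` prime to `21`;
  `re_embedding_prod_neg_iff`: the sign of `φ(± ∏_{a∈A} c_a)` is the parity of
  `#{a ∈ A : Xor …} + [sign]`.
* §5 `exists_units_coe_eq`: for `A ⊆ {2,4,5,8,10}` and a sign, **`± ∏_{a∈A} c_a` is (the image of) a unit of `𝓞 K`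
  fixed by complex conjugation** (inverse `± ∏ c_{a¹¹ mod 21}(ζ^a)`; reality read through an embedding, every
  `φ(c_a)` being real).

HONEST FRAMING: elementary algebra and trigonometry; the `c_a` are the classical real cyclotomic units; nothing here
mentions Hodge classes, `W_K` or HC; `HC_CM` is used nowhere.  No `def`, no named fact, no `sorry`.

References: [cite: Washington1997, §8.1 (cyclotomic units)]; census b01.23 (A) / b01.28 (seat-derived).
-/

noncomputable section

open Polynomial NumberField Complex Finset
open scoped Real

namespace Summit.HodgeConjecture.Ring2WeilCoverage.CyclotomicRealUnits

open Summit.HodgeConjecture.Ring2WeilCoverage.CyclotomicSkewSigns (toCircle_coe_eq_exp two_mul_I_mul_sin)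
open Summit.HodgeConjecture.Ring2WeilCoverage.CMTypeSignParity (prod_pos_iff_even_card_filter_neg)
open Literature.AlgebraicGeometry.ComplexMultiplication.CyclotomicCMType (exists_apply_eq_toCircle)

/-! ### §1 Telescoping: `c_a·(z − z^{20}) = z^a − z^{20a}` and `c_a · c_b(z^a) = 1` -/

/-- **`c_a(z)·(z − z^{20}) = z^a − z^{20a}`** for `c_a(z) = Σ_{j<a} z^{a−1+19j}` (telescoping; any commutative ring,
no relation on `z` needed).
research route conditional on HC_CM; not a corollary; Q11.4-sentence-2 already refuted in dim ≥ 3. [folklore] -/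
theorem csum_mul_sub {R : Type*} [CommRing R] (z : R) {a : ℕ} (ha : 0 < a) :
    (∑ j ∈ range a, z ^ (a - 1 + 19 * j)) * (z - z ^ 20) = z ^ a - z ^ (20 * a) := by
  rw [Finset.sum_mul]
  have h : ∀ j ∈ range a, z ^ (a - 1 + 19 * j) * (z - z ^ 20) =
      z ^ (a + 19 * j) - z ^ (a + 19 * (j + 1)) := by
    intro j _
    have e1 : a - 1 + 19 * j + 1 = a + 19 * j := by omega
    have e2 : a - 1 + 19 * j + 20 = a + 19 * (j + 1) := by omega
    rw [mul_sub, ← pow_succ, ← pow_add, e1, e2]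
  rw [Finset.sum_congr rfl h, Finset.sum_range_sub' (fun j => z ^ (a + 19 * j)) a]
  ring_nf

/-- **`c_a(z) · c_b(z^a) = 1`** for `z^{21} = 1`, `z ≠ z^{20}` and `ab ≡ 1 (mod 21)`: by §1 twice,
`c_a(z)c_b(z^a)(z − z^{20}) = c_b(z^a)(z^a − z^{20a}) = z^{ab} − z^{20ab} = z − z^{20}`.  So the real cyclotomic
unit `c_a` has the explicit inverse `c_b(ζ^a)`.
research route conditional on HC_CM; not a corollary; Q11.4-sentence-2 already refuted in dim ≥ 3. [cite: Washington1997, §8.1] -/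
theorem csum_mul_csum_eq_one {R : Type*} [Field R] {z : R} (hz : z ^ 21 = 1) (hz2 : z ≠ z ^ 20) {a b : ℕ}
    (ha : 0 < a) (hb : 0 < b) (hab : a * b % 21 = 1) :
    (∑ j ∈ range a, z ^ (a - 1 + 19 * j)) * (∑ j ∈ range b, (z ^ a) ^ (b - 1 + 19 * j)) = 1 := by
  set c := ∑ j ∈ range a, z ^ (a - 1 + 19 * j) with hc
  set d := ∑ j ∈ range b, (z ^ a) ^ (b - 1 + 19 * j) with hd
  have h1 : c * (z - z ^ 20) = z ^ a - z ^ (20 * a) := csum_mul_sub z ha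
  have hmod : a * (20 * b) % 21 = 20 := by
    rw [show a * (20 * b) = 20 * (a * b) by ring, Nat.mul_mod, hab]
  -- powers of `z` reduce mod `21` (the lane's `PAdicHodge.pow_eq_pow_mod_of_pow_eq_one`, inlined)
  have hred : ∀ k : ℕ, z ^ k = z ^ (k % 21) := fun k => by
    conv_lhs => rw [← Nat.mod_add_div k 21, pow_add, pow_mul, hz, one_pow, mul_one]
  have h2 : d * (z ^ a - z ^ (20 * a)) = z - z ^ 20 := by
    have := csum_mul_sub (z ^ a) hb
    rw [← pow_mul, ← pow_mul, ← pow_mul, show a * 20 = 20 * a by ring, hred (a * b), hab,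
      pow_one, hred (a * (20 * b)), hmod] at this
    exact this
  have hne : z - z ^ 20 ≠ 0 := sub_ne_zero.mpr hz2
  have key : (c * d) * (z - z ^ 20) = 1 * (z - z ^ 20) := by
    calc (c * d) * (z - z ^ 20) = d * (c * (z - z ^ 20)) := by ring
      _ = d * (z ^ a - z ^ (20 * a)) := by rw [h1]
      _ = z - z ^ 20 := h2
      _ = 1 * (z - z ^ 20) := (one_mul _).symm
  exact mul_right_cancel₀ hne key

/-! ### §2 The sign of `sin(2πm/n)` -/

/-- `sin(2πm/n) = sin(2π(m mod n)/n)`.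
research route conditional on HC_CM; not a corollary; Q11.4-sentence-2 already refuted in dim ≥ 3. [folklore] -/
theorem sin_two_pi_mul_div_eq_mod (m n : ℕ) (hn : 0 < n) :
    Real.sin (2 * π * m / n) = Real.sin (2 * π * (m % n : ℕ) / n) := by
  have hn' : (n : ℝ) ≠ 0 := Nat.cast_ne_zero.mpr hn.ne'
  conv_lhs => rw [← Nat.mod_add_div m n]
  rw [show (2 * π * ((m % n + n * (m / n) : ℕ) : ℝ) / n) = 2 * π * (m % n : ℕ) / n + ((m / n : ℕ) : ℝ) * (2 * π) by
    push_cast; field_simp]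
  exact Real.sin_add_nat_mul_two_pi _ _

/-- **`sin(2πm/n) < 0 ↔ n < 2(m mod n)`** (and `sin(2πm/n) ≠ 0`) when `n ∤ m` and `2(m mod n) ≠ n`: the reduced
angle `2π(m mod n)/n` lies in `(0, π)` or in `(π, 2π)`.
research route conditional on HC_CM; not a corollary; Q11.4-sentence-2 already refuted in dim ≥ 3. [folklore] -/
theorem sin_two_pi_mul_div_neg_iff {m n : ℕ} (hn : 0 < n) (h0 : m % n ≠ 0) (h2 : 2 * (m % n) ≠ n) :
    (Real.sin (2 * π * m / n) < 0 ↔ n < 2 * (m % n)) ∧ Real.sin (2 * π * m / n) ≠ 0 := by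
  rw [sin_two_pi_mul_div_eq_mod m n hn]
  set r := m % n with hr
  have hrn : r < n := Nat.mod_lt m hn
  have hnR : (0 : ℝ) < n := Nat.cast_pos.mpr hn
  have hx : 2 * π * (r : ℝ) / n = (2 * r / n : ℝ) * π := by ring
  rw [hx]
  rcases Nat.lt_or_gt_of_ne h2 with hlt | hgt
  · have h1 : 0 < (2 * r / n : ℝ) * π := by
      have : (0 : ℝ) < r := Nat.cast_pos.mpr (Nat.pos_of_ne_zero h0)
      positivity
    have h2' : (2 * r / n : ℝ) * π < π := by
      have : (2 * r / n : ℝ) < 1 := by rw [div_lt_one hnR]; exact_mod_cast hlt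
      nlinarith [Real.pi_pos]
    have hpos := Real.sin_pos_of_pos_of_lt_pi h1 h2'
    exact ⟨⟨fun h => absurd h (not_lt.mpr hpos.le), fun h => absurd hlt (not_lt.mpr h.le)⟩, hpos.ne'⟩
  · have h1 : 0 < (2 * r / n : ℝ) * π - π := by
      have : 1 < (2 * r / n : ℝ) := by rw [one_lt_div hnR]; exact_mod_cast hgt
      nlinarith [Real.pi_pos]
    have h2' : (2 * r / n : ℝ) * π - π < π := by
      have : (2 * r / n : ℝ) < 2 := by rw [div_lt_iff₀ hnR]; norm_cast; omega
      nlinarith [Real.pi_pos]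
    have hpos := Real.sin_pos_of_pos_of_lt_pi h1 h2'
    rw [Real.sin_sub_pi] at hpos
    have hneg : Real.sin ((2 * r / n : ℝ) * π) < 0 := by linarith
    exact ⟨⟨fun _ => hgt, fun _ => hneg⟩, hneg.ne⟩

/-! ### §3 The embedding value `φ(c_a) = sin(2πat/21)/sin(2πt/21)` -/

variable {K : Type} [Field K] [NumberField K] {ζ : K}

/-- `𝐞(t) = exp(2πi t/21) ∈ ℂ` (`ZMod.toCircle`). -/
local notation3 (prettyPrint := false) "𝐞 " t:max => ((ZMod.toCircle t : Circle) : ℂ)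

omit [NumberField K] in
/-- `𝐞(t)^k = exp((2πkt/21)·i)`.
research route conditional on HC_CM; not a corollary; Q11.4-sentence-2 already refuted in dim ≥ 3. [folklore] -/
theorem toCircle_pow_eq_exp (t : ZMod 21) (k : ℕ) :
    (𝐞 t) ^ k = cexp ((2 * π * ((k * t.val : ℕ) : ℝ) / 21 : ℝ) * I) := by
  rw [toCircle_coe_eq_exp, ← Complex.exp_nat_mul]
  congr 1
  push_cast
  ring

omit [NumberField K] in
/-- `𝐞(t)^k − (𝐞(t)^k)⁻¹ = 2i·sin(2πkt/21)`.
research route conditional on HC_CM; not a corollary; Q11.4-sentence-2 already refuted in dim ≥ 3. [folklore] -/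
theorem toCircle_pow_sub_inv (t : ZMod 21) (k : ℕ) :
    (𝐞 t) ^ k - ((𝐞 t) ^ k)⁻¹ = 2 * I * Complex.sin ((2 * π * ((k * t.val : ℕ) : ℝ) / 21 : ℝ)) := by
  rw [two_mul_I_mul_sin, toCircle_pow_eq_exp, ← Complex.exp_neg, neg_mul]

omit [NumberField K] in
/-- `𝐞(t)^{21} = 1`, hence `𝐞(t)^{20k} = (𝐞(t)^k)⁻¹`.
research route conditional on HC_CM; not a corollary; Q11.4-sentence-2 already refuted in dim ≥ 3. [folklore] -/
theorem toCircle_pow_twenty_mul (t : ZMod 21) (k : ℕ) : (𝐞 t) ^ (20 * k) = ((𝐞 t) ^ k)⁻¹ := by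
  have h21 : (𝐞 t) ^ 21 = 1 := by
    rw [toCircle_pow_eq_exp]
    have : ((2 * π * ((21 * t.val : ℕ) : ℝ) / 21 : ℝ) : ℂ) * I = (t.val : ℕ) * (2 * π * I) := by
      push_cast; ring
    rw [this]
    exact Complex.exp_nat_mul_two_pi_mul_I _
  symm
  apply inv_eq_of_mul_eq_one_right
  rw [← pow_add, show k + 20 * k = 21 * k by ring, pow_mul, h21, one_pow]

omit [NumberField K] in
/-- **`φ(c_a) = sin(2πat/21)/sin(2πt/21)`** for an embedding `φ` with `φ ζ = 𝐞(t)`, `t` a unit residue, `a ≥ 1`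
(§1 read in `ℂ`: `φ(c_a)·(𝐞(t) − 𝐞(t)⁻¹) = 𝐞(t)^a − 𝐞(t)^{−a}`, both differences being `2i·sin`).
research route conditional on HC_CM; not a corollary; Q11.4-sentence-2 already refuted in dim ≥ 3. [cite: Washington1997, §8.1] -/
theorem embedding_csum_eq {φ : K →+* ℂ} {t : ZMod 21} (hφ : φ ζ = 𝐞 t) (ht : t.val.Coprime 21) {a : ℕ}
    (ha : 0 < a) :
    φ (∑ j ∈ range a, ζ ^ (a - 1 + 19 * j)) =
      ((Real.sin (2 * π * ((a * t.val : ℕ) : ℝ) / 21) / Real.sin (2 * π * ((1 * t.val : ℕ) : ℝ) / 21) : ℝ) : ℂ) := by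
  have hval : φ (∑ j ∈ range a, ζ ^ (a - 1 + 19 * j)) = ∑ j ∈ range a, (𝐞 t) ^ (a - 1 + 19 * j) := by
    rw [map_sum]; simp only [map_pow, hφ]
  have htel := csum_mul_sub (𝐞 t) ha
  rw [← hval] at htel
  have h20 : (𝐞 t) ^ 20 = (𝐞 t)⁻¹ := by simpa using toCircle_pow_twenty_mul t 1
  rw [toCircle_pow_twenty_mul t a, h20] at htel
  have hs1 := toCircle_pow_sub_inv t 1
  have hsa := toCircle_pow_sub_inv t a
  rw [pow_one] at hs1
  rw [hs1, hsa] at htel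
  have ht0 : t.val % 21 ≠ 0 := by
    rw [Nat.mod_eq_of_lt (ZMod.val_lt t)]
    intro h; rw [h] at ht; norm_num at ht
  have ht2 : 2 * (t.val % 21) ≠ 21 := by omega
  have hsin1 := (sin_two_pi_mul_div_neg_iff (m := 1 * t.val) (n := 21) (by norm_num)
    (by simpa using ht0) (by simpa using ht2)).2
  have hne : (2 * I * Complex.sin ((2 * π * ((1 * t.val : ℕ) : ℝ) / 21 : ℝ)) : ℂ) ≠ 0 := by
    rw [← Complex.ofReal_sin]
    exact mul_ne_zero (mul_ne_zero two_ne_zero Complex.I_ne_zero) (Complex.ofReal_ne_zero.mpr hsin1)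
  have key : φ (∑ j ∈ range a, ζ ^ (a - 1 + 19 * j)) =
      (2 * I * Complex.sin ((2 * π * ((a * t.val : ℕ) : ℝ) / 21 : ℝ))) /
        (2 * I * Complex.sin ((2 * π * ((1 * t.val : ℕ) : ℝ) / 21 : ℝ))) := by
    rw [eq_div_iff hne]; simpa [one_mul] using htel
  rw [key, ← Complex.ofReal_sin, ← Complex.ofReal_sin]
  push_cast
  field_simp

/-! ### §4 Signs -/

omit [NumberField K] in
/-- **`Re φ(c_a) < 0 ↔ Xor (21 < 2((at) mod 21)) (21 < 2t)`** for `a` prime to `21`, `t` a unit residue with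
`φ ζ = 𝐞(t)`; and `φ(c_a)` is a NON-ZERO REAL number (the signs of `sin(2πat/21)` and `sin(2πt/21)` by §2).
research route conditional on HC_CM; not a corollary; Q11.4-sentence-2 already refuted in dim ≥ 3. [folklore] -/
theorem re_embedding_csum {φ : K →+* ℂ} {t : ZMod 21} (hφ : φ ζ = 𝐞 t) (ht : t.val.Coprime 21) {a : ℕ}
    (ha : 0 < a) (ha' : a.Coprime 21) :
    ((φ (∑ j ∈ range a, ζ ^ (a - 1 + 19 * j))).re < 0 ↔
        Xor (21 < 2 * ((a * t.val) % 21)) (21 < 2 * t.val)) ∧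
      (φ (∑ j ∈ range a, ζ ^ (a - 1 + 19 * j))).re ≠ 0 ∧
      (φ (∑ j ∈ range a, ζ ^ (a - 1 + 19 * j))).im = 0 := by
  rw [embedding_csum_eq hφ ht ha, Complex.ofReal_re, Complex.ofReal_im]
  have htlt := ZMod.val_lt t
  have ht0 : t.val % 21 ≠ 0 := by
    rw [Nat.mod_eq_of_lt htlt]; intro h; rw [h] at ht; norm_num at ht
  have hat0 : (a * t.val) % 21 ≠ 0 := by
    intro h
    have h21 : 21 ∣ a * t.val := Nat.dvd_of_mod_eq_zero h
    have hcop : (a * t.val).Coprime 21 := Nat.Coprime.mul_left ha' ht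
    have := Nat.eq_one_of_dvd_coprimes hcop h21 (dvd_refl 21)
    norm_num at this
  obtain ⟨hsa, hsa0⟩ := sin_two_pi_mul_div_neg_iff (m := a * t.val) (n := 21) (by norm_num) hat0 (by omega)
  obtain ⟨hs1, hs10⟩ := sin_two_pi_mul_div_neg_iff (m := 1 * t.val) (n := 21) (by norm_num)
    (by simpa using ht0) (by omega)
  have hmod1 : 1 * t.val % 21 = t.val := by rw [one_mul, Nat.mod_eq_of_lt htlt]
  rw [hmod1] at hs1
  refine ⟨?_, div_ne_zero hsa0 hs10, rfl⟩
  rw [div_neg_iff, ← hsa, ← hs1]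
  constructor
  · rintro (⟨h1, h2⟩ | ⟨h1, h2⟩)
    · exact Or.inr ⟨h2, not_lt.mpr h1.le⟩
    · exact Or.inl ⟨h1, not_lt.mpr h2.le⟩
  · rintro (⟨h1, h2⟩ | ⟨h1, h2⟩)
    · exact Or.inr ⟨h1, lt_of_le_of_ne (not_lt.mp h2) hs10.symm⟩
    · exact Or.inl ⟨lt_of_le_of_ne (not_lt.mp h2) hsa0.symm, h1⟩

omit [NumberField K] in
/-- **Sign of a signed product**: for `A` a set of exponents prime to `21`, a sign `ε` and `φ ζ = 𝐞(t)`: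
`Re φ(± ∏_{a∈A} c_a) < 0 ↔ #{a ∈ A : Xor (21 < 2((at) mod 21)) (21 < 2t)} + [ε]` is odd; and the real part is
non-zero.  (All `φ(c_a)` are real; gen 55's `prod_pos_iff_even_card_filter_neg`.)
research route conditional on HC_CM; not a corollary; Q11.4-sentence-2 already refuted in dim ≥ 3. [folklore] -/
theorem re_embedding_prod_neg_iff {φ : K →+* ℂ} {t : ZMod 21} (hφ : φ ζ = 𝐞 t) (ht : t.val.Coprime 21)
    (A : Finset ℕ) (hA : ∀ a ∈ A, 0 < a ∧ a.Coprime 21) (ε : Bool) :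
    ((φ ((if ε then -1 else 1) * ∏ a ∈ A, ∑ j ∈ range a, ζ ^ (a - 1 + 19 * j))).re < 0 ↔
        Odd ((A.filter fun a => Xor (21 < 2 * ((a * t.val) % 21)) (21 < 2 * t.val)).card +
          (if ε then 1 else 0))) ∧
      (φ ((if ε then -1 else 1) * ∏ a ∈ A, ∑ j ∈ range a, ζ ^ (a - 1 + 19 * j))).re ≠ 0 := by
  have hreal : ∀ a ∈ A, φ (∑ j ∈ range a, ζ ^ (a - 1 + 19 * j)) =
      (((φ (∑ j ∈ range a, ζ ^ (a - 1 + 19 * j))).re : ℝ) : ℂ) := fun a haA =>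
    Complex.ext (by simp) (by rw [Complex.ofReal_im]; exact (re_embedding_csum hφ ht (hA a haA).1 (hA a haA).2).2.2)
  have hprod : φ (∏ a ∈ A, ∑ j ∈ range a, ζ ^ (a - 1 + 19 * j)) =
      ((∏ a ∈ A, (φ (∑ j ∈ range a, ζ ^ (a - 1 + 19 * j))).re : ℝ) : ℂ) := by
    rw [map_prod, Complex.ofReal_prod]
    exact Finset.prod_congr rfl hreal
  have hne : ∀ a ∈ A, (φ (∑ j ∈ range a, ζ ^ (a - 1 + 19 * j))).re ≠ 0 := fun a haA =>
    (re_embedding_csum hφ ht (hA a haA).1 (hA a haA).2).2.1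
  have hP : ∏ a ∈ A, (φ (∑ j ∈ range a, ζ ^ (a - 1 + 19 * j))).re ≠ 0 := Finset.prod_ne_zero_iff.mpr hne
  have hpos := prod_pos_iff_even_card_filter_neg A (fun a => (φ (∑ j ∈ range a, ζ ^ (a - 1 + 19 * j))).re) hne
  have hfilter : (A.filter fun a => (φ (∑ j ∈ range a, ζ ^ (a - 1 + 19 * j))).re < 0) =
      A.filter fun a => Xor (21 < 2 * ((a * t.val) % 21)) (21 < 2 * t.val) := by
    apply Finset.filter_congr
    intro a haA
    exact (re_embedding_csum hφ ht (hA a haA).1 (hA a haA).2).1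
  rw [hfilter] at hpos
  rw [map_mul, hprod]
  cases ε
  · simp only [Bool.false_eq_true, ↓reduceIte, map_one, one_mul, Complex.ofReal_re, add_zero]
    refine ⟨?_, hP⟩
    rw [← Nat.not_even_iff_odd, ← hpos, not_lt]
    exact ⟨fun h => h.le, fun h => lt_of_le_of_ne h hP⟩
  · simp only [↓reduceIte, map_neg, map_one, neg_mul, one_mul, Complex.neg_re, Complex.ofReal_re, neg_lt_zero,
      ne_eq, neg_eq_zero]
    refine ⟨?_, hP⟩
    rw [hpos, Nat.odd_add_one, Nat.not_odd_iff_even]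

/-! ### §5 The signed products are real units of `𝓞 K` -/

/-- Arithmetic of the exponents `a ∈ {2,4,5,8,10}`: `a ≥ 1`, prime to `21`, with inverse `a¹¹ mod 21`.
research route conditional on HC_CM; not a corollary; Q11.4-sentence-2 already refuted in dim ≥ 3. [folklore] -/
theorem gens_arith : ∀ a ∈ ({2, 4, 5, 8, 10} : Finset ℕ),
    0 < a ∧ a.Coprime 21 ∧ 0 < a ^ 11 % 21 ∧ a * (a ^ 11 % 21) % 21 = 1 := by
  decide

/-- **`± ∏_{a∈A} c_a` is a unit of `𝓞 K` fixed by complex conjugation** (`A ⊆ {2,4,5,8,10}`, `K` a CM field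
containing a primitive `21`-st root of unity `ζ`): the inverse is `± ∏ c_{a¹¹ mod 21}(ζ^a)` (§1), and reality is
read through an embedding (every `φ(c_a)` is real, §4).
research route conditional on HC_CM; not a corollary; Q11.4-sentence-2 already refuted in dim ≥ 3. [cite: Washington1997, §8.1] -/
theorem exists_units_coe_eq [IsCMField K] (hζ : IsPrimitiveRoot ζ 21) {A : Finset ℕ}
    (hA : A ⊆ ({2, 4, 5, 8, 10} : Finset ℕ)) (ε : Bool) :
    ∃ u : (𝓞 K)ˣ, ((u : 𝓞 K) : K) = (if ε then -1 else 1) * ∏ a ∈ A, ∑ j ∈ range a, ζ ^ (a - 1 + 19 * j) ∧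
      IsCMField.complexConj K ((u : 𝓞 K) : K) = ((u : 𝓞 K) : K) := by
  have h21 : ζ ^ 21 = 1 := hζ.pow_eq_one
  have hz2 : ζ ≠ ζ ^ 20 := by
    intro h
    have h2 : ζ ^ 2 = 1 := by
      calc ζ ^ 2 = ζ * ζ := sq ζ
        _ = ζ ^ 20 * ζ := by rw [← h]
        _ = ζ ^ 21 := by ring
        _ = 1 := h21
    have := (hζ.pow_eq_one_iff_dvd 2).mp h2
    omega
  obtain ⟨U, hUK⟩ : ∃ U : 𝓞 K, (U : K) = (if ε then -1 else 1) * ∏ a ∈ A, ∑ j ∈ range a, ζ ^ (a - 1 + 19 * j) :=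
    ⟨(if ε then -1 else 1) * ∏ a ∈ A, ∑ j ∈ range a, hζ.toInteger ^ (a - 1 + 19 * j), by
      cases ε <;> push_cast <;> rfl⟩
  obtain ⟨V, hVK⟩ : ∃ V : 𝓞 K, (V : K) = (if ε then -1 else 1) *
      ∏ a ∈ A, ∑ j ∈ range (a ^ 11 % 21), (ζ ^ a) ^ (a ^ 11 % 21 - 1 + 19 * j) :=
    ⟨(if ε then -1 else 1) * ∏ a ∈ A, ∑ j ∈ range (a ^ 11 % 21), (hζ.toInteger ^ a) ^ (a ^ 11 % 21 - 1 + 19 * j),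
      by cases ε <;> push_cast <;> rfl⟩
  have hUV : U * V = 1 := by
    rw [RingOfIntegers.ext_iff]
    push_cast
    have hs : ((if ε then -1 else 1 : K)) * (if ε then -1 else 1 : K) = 1 := by cases ε <;> simp
    refine (show (U : K) * (V : K) = 1 from ?_)
    rw [hUK, hVK]
    calc ((if ε then -1 else 1 : K) * ∏ a ∈ A, ∑ j ∈ range a, ζ ^ (a - 1 + 19 * j)) *
          ((if ε then -1 else 1 : K) * ∏ a ∈ A, ∑ j ∈ range (a ^ 11 % 21), (ζ ^ a) ^ (a ^ 11 % 21 - 1 + 19 * j))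
        = (((if ε then -1 else 1 : K)) * (if ε then -1 else 1 : K)) *
          ∏ a ∈ A, ((∑ j ∈ range a, ζ ^ (a - 1 + 19 * j)) *
            ∑ j ∈ range (a ^ 11 % 21), (ζ ^ a) ^ (a ^ 11 % 21 - 1 + 19 * j)) := by
          rw [Finset.prod_mul_distrib]; ring
      _ = 1 := by
          rw [hs, one_mul]
          refine Finset.prod_eq_one fun a haA => ?_
          obtain ⟨ha0, -, hb0, hab⟩ := gens_arith a (hA haA)
          exact csum_mul_csum_eq_one h21 hz2 ha0 hb0 hab
  refine ⟨Units.mkOfMulEqOne U V hUV, ?_, ?_⟩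
  · rw [Units.val_mkOfMulEqOne, hUK]
  · rw [Units.val_mkOfMulEqOne]
    obtain ⟨φ⟩ := (inferInstance : Nonempty (K →+* ℂ))
    obtain ⟨t, ht, hφt⟩ := exists_apply_eq_toCircle hζ φ
    apply φ.injective
    rw [IsCMField.complexEmbedding_complexConj, hUK]
    have hA' : ∀ a ∈ A, 0 < a ∧ a.Coprime 21 := fun a haA =>
      ⟨(gens_arith a (hA haA)).1, (gens_arith a (hA haA)).2.1⟩
    have him : ∀ a ∈ A, (φ (∑ j ∈ range a, ζ ^ (a - 1 + 19 * j))).im = 0 := fun a haA =>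
      (re_embedding_csum hφt ht (hA' a haA).1 (hA' a haA).2).2.2
    have hreal : φ (∏ a ∈ A, ∑ j ∈ range a, ζ ^ (a - 1 + 19 * j)) =
        ((∏ a ∈ A, (φ (∑ j ∈ range a, ζ ^ (a - 1 + 19 * j))).re : ℝ) : ℂ) := by
      rw [map_prod, Complex.ofReal_prod]
      exact Finset.prod_congr rfl fun a haA => Complex.ext (by simp) (by rw [Complex.ofReal_im]; exact him a haA)
    rw [map_mul, hreal]
    cases ε <;> simp [Complex.conj_ofReal]

end Summit.HodgeConjecture.Ring2WeilCoverage.CyclotomicRealUnits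

end
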